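import Mathlib
import HarnessLib
import Summits.Ventures.LatticeQCDFlow.Exactness.SpectralKernelMap

/-!
# The spectral kernel is a polynomial in its argument: `h(P) = q(P)` for any `q` interpolating the eigenvalue map on the spectrum — "leaves the eigenvectors unchanged", literally

HONEST FRAMING: exact (Metropolis-corrected) sampling algorithms for lattice gauge theory;
figures of merit are autocorrelation/cost numbers at stated couplings and volumes; no
continuum-physics claim.

Venture `LatticeQCDFlow` (cell pub-lqcd), topic `Exactness`; FANOUT row 10 (`eng-equiv`, engine
`latflow.equiv`, `equiv/spectral.py` `spectral_kernel` / `recompose`).  NEW WORK of the cell over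
`SpectralKernelConjugation.lean` / `SpectralKernelMap.lean` and Mathlib's `Lagrange.interpolate`;
nothing is cited as a fact; no number; no definition is introduced.  A CHOICE-FREE description of
the kernel that `SpectralKernelMap` constructed by choosing diagonalisations: on a matrix with
spectrum `{d_i}` the kernel of a permutation-equivariant `f` acts as ANY polynomial `q ∈ ℂ[X]`
with `q(d_i) = (f d)_i` — such a `q` exists exactly because tied eigenvalues get tied images
(`apply_eq_apply_of_perm_equivariant`).  Printed counterpart, NAMED ONLY: Boyda et al., PRD 103
(2021) 074504 §III / App. A ("acts on the list of eigenvalues … and leaves the eigenvectors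
unchanged").

## Content (`n` any finite index type; matrices over `ℂ`)

* `aeval_diagonal_complex` — `q(diag d) = diag(q(d_i))`; `aeval_conj_of_mem_unitaryGroup` —
  `q(V D V⋆) = V q(D) V⋆` for `V ∈ U(n)`;
* **`conj_diagonal_eq_aeval`** — if `q(d_i) = e_i` for all `i` then `V diag(e) V⋆ = q(V diag(d) V⋆)`:
  the recomposed matrix is a polynomial in the input;
* **`exists_polynomial_interpolating`** — for `e` constant on the level sets of `d` (e.g.
  `e = f d` with `f` permutation equivariant, `exists_polynomial_interpolating_of_perm_equivariant`)
  there is `q ∈ ℂ[X]` with `q(d_i) = e_i` (Lagrange interpolation on the distinct eigenvalues);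
* **`spectralKernel_unitaryGroup_eq_aeval`** / **`spectralKernel_specialUnitaryGroup_eq_aeval`** —
  any kernel agreeing with the spectral recipe of `f` satisfies `h P = q(P)` for every `q`
  interpolating `f` on the spectrum of `P`; hence `h P` commutes with everything that commutes
  with `P` (`spectralKernel_unitaryGroup_commute_of_commute`) — in particular with `P`.

NOT here: continuity of `P ↦ h P` (the interpolating polynomial depends on the spectrum); any
number.
-/

namespace Summit.Ventures.LatticeQCDFlow.Exactness

open Matrix Polynomial
open Literature.LinearAlgebra.Matrix

variable {n : Type*} [Fintype n] [DecidableEq n]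

/-! ## Polynomials in diagonal and in conjugated matrices -/

/-- `q(diag d) = diag(q(d_i))`. -/
theorem aeval_diagonal_complex (d : n → ℂ) (q : ℂ[X]) :
    aeval (diagonal d) q = diagonal fun i => q.eval (d i) := by
  induction q using Polynomial.induction_on' with
  | add p r hp hr =>
    rw [map_add, hp, hr, diagonal_add]
    simp only [eval_add]
  | monomial k a =>
    rw [aeval_monomial, Algebra.algebraMap_eq_smul_one, smul_mul_assoc, one_mul, diagonal_pow,
      ← diagonal_smul]
    congr 1
    funext i
    simp [eval_monomial]

/-- `q(V D V⋆) = V q(D) V⋆` for `V ∈ U(n)`. -/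
theorem aeval_conj_of_mem_unitaryGroup {V : Matrix n n ℂ} (hV : V ∈ Matrix.unitaryGroup n ℂ)
    (D : Matrix n n ℂ) (q : ℂ[X]) : aeval (V * D * star V) q = V * aeval D q * star V := by
  have hVs : star V * V = 1 := Unitary.star_mul_self_of_mem hV
  have hVs' : V * star V = 1 := Unitary.mul_star_self_of_mem hV
  induction q using Polynomial.induction_on' with
  | add p r hp hr => rw [map_add, map_add, hp, hr, Matrix.mul_add, Matrix.add_mul]
  | monomial k a =>
    simp only [aeval_monomial, Algebra.algebraMap_eq_smul_one, smul_mul_assoc, one_mul, Matrix.mul_smul]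
    congr 1
    induction k with
    | zero => rw [pow_zero, pow_zero, Matrix.mul_one, hVs']
    | succ k ih =>
      rw [pow_succ, ih, pow_succ]
      calc V * D ^ k * star V * (V * D * star V) = V * D ^ k * (star V * V) * D * star V := by
            simp only [Matrix.mul_assoc]
        _ = V * (D ^ k * D) * star V := by rw [hVs, Matrix.mul_one]; simp only [Matrix.mul_assoc]

/-- **The recomposed matrix is a polynomial in the input.**  If `q(d_i) = e_i` for all `i`, then
`V diag(e) V⋆ = q(V diag(d) V⋆)` (`V ∈ U(n)`). -/
theorem conj_diagonal_eq_aeval {V : Matrix n n ℂ} (hV : V ∈ Matrix.unitaryGroup n ℂ) {d e : n → ℂ}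
    {q : ℂ[X]} (hq : ∀ i, q.eval (d i) = e i) :
    V * diagonal e * star V = aeval (V * diagonal d * star V) q := by
  rw [aeval_conj_of_mem_unitaryGroup hV, aeval_diagonal_complex]
  congr 3
  funext i
  rw [hq i]

/-! ## An interpolating polynomial exists iff ties are respected -/

omit [DecidableEq n] in
/-- **Lagrange interpolation on the spectrum.**  If `e` is constant on the level sets of `d`
(`d i = d j → e i = e j`), there is `q ∈ ℂ[X]` with `q(d_i) = e_i` for all `i` (interpolate on
the finite set of distinct values of `d`). -/
theorem exists_polynomial_interpolating {d e : n → ℂ} (hde : ∀ i j, d i = d j → e i = e j) :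
    ∃ q : ℂ[X], ∀ i, q.eval (d i) = e i := by
  classical
  -- value attached to each point of the spectrum
  let r : ℂ → ℂ := fun z => if h : ∃ i, d i = z then e h.choose else 0
  have hr : ∀ i, r (d i) = e i := by
    intro i
    have h : ∃ j, d j = d i := ⟨i, rfl⟩
    simp only [r, dif_pos h]
    exact hde _ _ h.choose_spec
  refine ⟨Lagrange.interpolate (Finset.univ.image d) id r, fun i => ?_⟩
  have hnode := Lagrange.eval_interpolate_at_node (v := id) (s := Finset.univ.image d) r
    (Set.injOn_id _) (Finset.mem_image_of_mem d (Finset.mem_univ i))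
  rw [id] at hnode
  rw [hnode, hr]

/-- For a permutation-equivariant eigenvalue map the ties are respected, so an interpolating
polynomial exists: `q(d_i) = (f d)_i`. -/
theorem exists_polynomial_interpolating_of_perm_equivariant {f : (n → ℂ) → (n → ℂ)}
    (hf : ∀ (σ : Equiv.Perm n) (d : n → ℂ), f (fun k => d (σ k)) = fun k => f d (σ k)) (d : n → ℂ) :
    ∃ q : ℂ[X], ∀ i, q.eval (d i) = f d i :=
  exists_polynomial_interpolating fun _ _ hij => apply_eq_apply_of_perm_equivariant hf hij

/-! ## The kernel is `q(P)` -/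

/-- **`h P = q(P)` on `U(n)`.**  A kernel agreeing with the spectral recipe of `f` evaluates, on
every `P ∈ U(n)` with a diagonalisation `P = V diag(d) V⋆`, to `q(P)` for ANY polynomial `q`
interpolating `f d` on the spectrum `d`. -/
theorem spectralKernel_unitaryGroup_eq_aeval {f : (n → ℂ) → (n → ℂ)}
    {h : Matrix.unitaryGroup n ℂ → Matrix.unitaryGroup n ℂ}
    (hagree : ∀ (P : Matrix.unitaryGroup n ℂ) (V : Matrix n n ℂ) (d : n → ℂ),
      V ∈ Matrix.unitaryGroup n ℂ → (P : Matrix n n ℂ) = V * diagonal d * star V →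
        ((h P : Matrix.unitaryGroup n ℂ) : Matrix n n ℂ) = V * diagonal (f d) * star V)
    (P : Matrix.unitaryGroup n ℂ) {V : Matrix n n ℂ} {d : n → ℂ} (hV : V ∈ Matrix.unitaryGroup n ℂ)
    (hP : (P : Matrix n n ℂ) = V * diagonal d * star V) {q : ℂ[X]} (hq : ∀ i, q.eval (d i) = f d i) :
    ((h P : Matrix.unitaryGroup n ℂ) : Matrix n n ℂ) = aeval (P : Matrix n n ℂ) q := by
  rw [hagree P V d hV hP, hP]
  exact conj_diagonal_eq_aeval hV hq

/-- **`h P = q(P)` on `SU(n)`.** -/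
theorem spectralKernel_specialUnitaryGroup_eq_aeval {f : (n → ℂ) → (n → ℂ)}
    {h : Matrix.specialUnitaryGroup n ℂ → Matrix.specialUnitaryGroup n ℂ}
    (hagree : ∀ (P : Matrix.specialUnitaryGroup n ℂ) (V : Matrix n n ℂ) (d : n → ℂ),
      V ∈ Matrix.unitaryGroup n ℂ → (P : Matrix n n ℂ) = V * diagonal d * star V →
        ((h P : Matrix.specialUnitaryGroup n ℂ) : Matrix n n ℂ) = V * diagonal (f d) * star V)
    (P : Matrix.specialUnitaryGroup n ℂ) {V : Matrix n n ℂ} {d : n → ℂ} (hV : V ∈ Matrix.unitaryGroup n ℂ)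
    (hP : (P : Matrix n n ℂ) = V * diagonal d * star V) {q : ℂ[X]} (hq : ∀ i, q.eval (d i) = f d i) :
    ((h P : Matrix.specialUnitaryGroup n ℂ) : Matrix n n ℂ) = aeval (P : Matrix n n ℂ) q := by
  rw [hagree P V d hV hP, hP]
  exact conj_diagonal_eq_aeval hV hq

/-- **Existence form (`U(n)`)**: for a permutation-equivariant `f`, every `P ∈ U(n)` has a
polynomial `q` with `h P = q(P)`. -/
theorem exists_spectralKernel_unitaryGroup_eq_aeval {f : (n → ℂ) → (n → ℂ)}
    (hf : ∀ (σ : Equiv.Perm n) (d : n → ℂ), f (fun k => d (σ k)) = fun k => f d (σ k))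
    {h : Matrix.unitaryGroup n ℂ → Matrix.unitaryGroup n ℂ}
    (hagree : ∀ (P : Matrix.unitaryGroup n ℂ) (V : Matrix n n ℂ) (d : n → ℂ),
      V ∈ Matrix.unitaryGroup n ℂ → (P : Matrix n n ℂ) = V * diagonal d * star V →
        ((h P : Matrix.unitaryGroup n ℂ) : Matrix n n ℂ) = V * diagonal (f d) * star V)
    (P : Matrix.unitaryGroup n ℂ) :
    ∃ q : ℂ[X], ((h P : Matrix.unitaryGroup n ℂ) : Matrix n n ℂ) = aeval (P : Matrix n n ℂ) q := by
  obtain ⟨V, hV, d, hP⟩ := exists_eq_conj_diagonal_of_mem_unitaryGroup P.2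
  obtain ⟨q, hq⟩ := exists_polynomial_interpolating_of_perm_equivariant hf d
  exact ⟨q, spectralKernel_unitaryGroup_eq_aeval hagree P hV hP hq⟩

/-- **Hence the kernel commutes with the commutant of its argument** ("leaves the eigenvectors
unchanged"): `A P = P A ⟹ A (h P) = (h P) A`, for a permutation-equivariant recipe on `U(n)`
(polynomials in `P` commute with whatever `P` commutes with). -/
theorem spectralKernel_unitaryGroup_commute_of_commute {f : (n → ℂ) → (n → ℂ)}
    (hf : ∀ (σ : Equiv.Perm n) (d : n → ℂ), f (fun k => d (σ k)) = fun k => f d (σ k))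
    {h : Matrix.unitaryGroup n ℂ → Matrix.unitaryGroup n ℂ}
    (hagree : ∀ (P : Matrix.unitaryGroup n ℂ) (V : Matrix n n ℂ) (d : n → ℂ),
      V ∈ Matrix.unitaryGroup n ℂ → (P : Matrix n n ℂ) = V * diagonal d * star V →
        ((h P : Matrix.unitaryGroup n ℂ) : Matrix n n ℂ) = V * diagonal (f d) * star V)
    (P : Matrix.unitaryGroup n ℂ) {A : Matrix n n ℂ} (hA : A * (P : Matrix n n ℂ) = (P : Matrix n n ℂ) * A) :
    A * ((h P : Matrix.unitaryGroup n ℂ) : Matrix n n ℂ) = ((h P : Matrix.unitaryGroup n ℂ) : Matrix n n ℂ) * A := by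
  obtain ⟨q, hq⟩ := exists_spectralKernel_unitaryGroup_eq_aeval hf hagree P
  have hc : Commute A (P : Matrix n n ℂ) := hA
  rw [hq, aeval_eq_sum_range]
  exact (Commute.sum_right _ _ _ fun i _ => (hc.pow_right i).smul_right _).eq

end Summit.Ventures.LatticeQCDFlow.Exactness
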